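import Summits.QuantumFields.YangMills.Theses.UnitScaleTilt
import Literature.MathematicalPhysics.QuantumFieldTheory.Balaban1983to89.T3SplitLog
import Literature.MathematicalPhysics.QuantumFieldTheory.Balaban1983to89.T3UpperLiftSplitLog
import Literature.MathematicalPhysics.QuantumFieldTheory.Balaban1983to89.T3ExistSplit
import Summits.QuantumFields.YangMills.Theorems.UnitScaleTiltMinimiserStabilityRegPrAvgActionDefect
import Summits.QuantumFields.YangMills.Theorems.UnitScaleTiltMinimiserStabilityRegPrAvgCurvGrad
import Summits.QuantumFields.YangMills.Theorems.UnitScaleTiltMinimiserStabilityRegPrSmoothLift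
import Summits.QuantumFields.YangMills.Theorems.UnitScaleTiltMinimiserStabilityRegPrCritCurvGradLog
import Summits.QuantumFields.YangMills.Theorems.UnitScaleTiltMinimiserStabilityRegPrProp8Iter
import Summits.QuantumFields.YangMills.Theorems.UnitScaleTiltMinimiserStabilityRegPrAttainmentOfExist
import HarnessLib

/-!
# Route `UnitScaleTilt`, crux K1 «MinimiserStabilityRegPr» (stmt-QuantumFields-19200) — THE «EVENTUALLY-IN-HEIGHT» DOOR:
# `MinimiserStabilityRegPr` ⟸ the halving text (`stub_halvingStep` VERBATIM) ∧ **EX-ev** := the existence text (`stub_existenceMinimalOrbit`) weakened by ONE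
# per-family height rider `n₀(F) ≤ n` — so a supplier of Prop. 7 (ii) that carries a volume∕height threshold of the shape «`a′(L) + 3 ≤ F.m + n`»
# ([Balaban1985BackgroundPropagators] Thm 3.1: the unit torus must contain big blocks of size `M = L^{a′}`) closes the crux WITHOUT cover descent

Cell `ym3-torus` (HUMAN RULING D-0037, YM ladder rung R3 — YM₃ on T³ is a rung, NOT d = 4, NOT infinite volume, NOT a mass gap, NOT Clay; YM gap NOT proved), width seat
`ym3-torus-px12` (gen 10), LOCATE `LOCATE-I06-VOLUME-RIDERS-px12g10.md` (19200 evidence) road (R1).  THEOREMS ONLY (0 `def`, 0 `sorry`); `--supports stmt-QuantumFields-19200 --as helper`;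
count-neutral.  A PARALLEL DOOR (no registry∕binder edit): the registered skeleton `Cruxes/MinimiserStabilityRegPr/Lines/birth_v10.lean` and its two stubs are untouched; nothing of
[Balaban1985Variational] Prop. 7 ∕ Prop. 8 ∕ [Balaban1985BackgroundPropagators] §3 is proved here — both texts are HYPOTHESES of the door.

WHY (located, LOCATE §3).  The layer-3 schemas of `T3PrintedRegularMinimiserReduction` are «eventually in `K`» per family (`HasRegMinimisersPrAt := ∃ K₀, ∀ K ≥ K₀ …`,
`UpperAlong…`, `LowerAlong…`; `minimiserStabilityRegPrAt_of_eventually`), and layer 3 only reads the members `(F, ⌊K∕m⌋, K)`, `(F, ⌊K∕m⌋, K+1)`; layer 2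
(`AttainmentOfExist.background_of_exist_T3`, induction on `K − n`) reads the existence clause at the heights `n, n+1, …, K−1` of the same `(F, K)` — UPWARD-CLOSED in `n`.
Hence a rider `n₀(F) ≤ n` threads through with `K₀ := m·n₀(F) + 1`.

WHAT IS PROVED (sorry-free, no definition).
§1 `isMinOn_big_mem_small_of_existEv_T3`, `background_of_existEv_T3`, **`minSixAttainedEv_of_existEv_prop8`** — `AttainmentOfExist` §1∕§3 with the rider carried
   (attainment over (6)(ε₀) for the members with `n₀(F) ≤ n`).
§2 **`hasRegMinimisersPrAt_of_attainedEv`** — `T3ExistSplit.hasRegMinimisersPrAt_of_attained` with the rider (`K₀ := m·n₀(F) + 1`).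
§3 **`minimiserStabilityRegPr_of_halving_existEv : ⟨stub_halvingStep text⟩ → ⟨EX-ev text⟩ → Theses.UnitScaleTilt.MinimiserStabilityRegPr`** — `birth_v10` §2–§3 replayed over the
   landed leaves (`Prop8Iter.prop8_of_halvingLiteral`, `CritCurvGradLog.stub_critCurvGradLog`, `SmoothLift`, `AvgCurvGrad`, `AvgActionDefect`, the split-log UPPER∕LOWER composers);
   and `existEv_of_exist` (the registered all-member EX text implies EX-ev with `n₀ := 0`): composing the two recovers, BY NAME and not restated here, the landed all-member
   door ✓`AttainmentOfExistence.MinimiserStabilityRegPr_of_halvingStep_of_existence` (`Theorems/UnitScaleTiltMinimiserStabilityRegPrOfHalvingExistence.lean`).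

HONEST SCOPE.  Plumbing over landed theorems; the two hypotheses are Bałaban's Prop. 8 (halving, Sect. F) and Prop. 7 (ii) (existence of a minimal orbit over a (14)-background) for
the members above a per-family height threshold; neither is proved; the L-floor riders (`4 ≤ ℓ`) of the N06 suppliers are NOT addressed; rung R3 bookkeeping, not T⁴, not Clay.

References: T. Bałaban, CMP 102 (1985) 277–309 [Balaban1985Variational] (Thm 1 (8) p.279, Sect. A (11)–(14) pp.279–280, Prop. 7 p.299, Prop. 8 p.304); CMP 99 (1985) 389–434
[Balaban1985BackgroundPropagators] (Thm 3.1 p.397, Sect. C p.408 «R, M sufficiently large … powers of L»); CMP 102 (1985) 255–275 [Balaban1985UV3] ((41) p.266, p.256–257).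
-/

set_option autoImplicit false

noncomputable section

open MeasureTheory Filter Topology
open scoped Matrix.Norms.L2Operator
open Literature.MathematicalPhysics.QuantumFieldTheory.Balaban1983to89
open Literature.MathematicalPhysics.QuantumFieldTheory.Balaban1983to89.T3ContinuumYM3Torus
open Literature.MathematicalPhysics.QuantumFieldTheory.Balaban1983to89.T3UnitLawDensityEML (ℰp measurableE_ℰp)
open Literature.MathematicalPhysics.QuantumFieldTheory.Balaban1983to89.T3UnitScaleTilt
open Literature.MathematicalPhysics.QuantumFieldTheory.Balaban1983to89.T3TiltDescent
open Literature.MathematicalPhysics.QuantumFieldTheory.Balaban1983to89.T3CruxEstimates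
open Literature.MathematicalPhysics.QuantumFieldTheory.Balaban1983to89.T3ConstrainedMinimiser
open Literature.MathematicalPhysics.QuantumFieldTheory.Balaban1983to89.T3DescentFibreTower
open Literature.MathematicalPhysics.QuantumFieldTheory.Balaban1983to89.T3MinimiserStabilityReduction
open Literature.MathematicalPhysics.QuantumFieldTheory.Balaban1983to89.T3RegularMinimiser
open Literature.MathematicalPhysics.QuantumFieldTheory.Balaban1983to89.T3PrintedRegularMinimiser
open Literature.MathematicalPhysics.QuantumFieldTheory.Balaban1983to89.T3PrintedRegularMinimiserReduction
open Literature.MathematicalPhysics.QuantumFieldTheory.Balaban1983to89.T3PrintedMinimiserExistence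
open Literature.MathematicalPhysics.QuantumFieldTheory.Balaban1983to89.T3LowerAlongMinimisersSplit
open Literature.MathematicalPhysics.QuantumFieldTheory.Balaban1983to89.T3AvgDivergenceSplit
open Literature.MathematicalPhysics.QuantumFieldTheory.Balaban1983to89.T3UpperAlongMinimisersSplit
open Literature.MathematicalPhysics.QuantumFieldTheory.Balaban1983to89.T3UpperLiftSplit
open Literature.MathematicalPhysics.QuantumFieldTheory.Balaban1983to89.T3LowerActionSplit
open Literature.MathematicalPhysics.QuantumFieldTheory.Balaban1983to89.T3ExistSplit
open Literature.MathematicalPhysics.QuantumFieldTheory.Balaban1983to89.T3Thm1Carrier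
open Literature.MathematicalPhysics.QuantumFieldTheory.Balaban1983to89.T3CurvGradLog
open Literature.MathematicalPhysics.QuantumFieldTheory.Balaban1983to89.T3SplitLog
open Literature.MathematicalPhysics.QuantumFieldTheory.Balaban1983to89.T3UpperLiftSplitLog
open Literature.MathematicalPhysics.QuantumFieldTheory.Balaban1983to89.T3SectASteps
open Literature.MathematicalPhysics.QuantumFieldTheory.Balaban1983to89.T3ThresholdSmallness
open Literature.MathematicalPhysics.QuantumFieldTheory.Balaban1983to89.B11 (Prop8Printed)

namespace Summit.QuantumFields.YangMills.Theorems.MinimiserStabilityRegPrOfExistEv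

open Summit.QuantumFields.YangMills.Theorems.AttainmentOfExist

/-! ## §1 Attainment over (6)(ε₀) above a per-family height threshold, from EX-ev and Prop. 8 (`AttainmentOfExist` §1∕§3 with the rider carried) -/

/-- **PROP 7 (ii) above the threshold ∧ PROP 8 ⇒ a minimiser over the BIG fibre lying in the SMALL fibre**, at one member `(F, n, K)` with `n₀ F ≤ n`
(`AttainmentOfExist.isMinOn_big_mem_small_of_exist_T3` with the existence hypothesis restricted to the heights `n₀(F) ≤ n`).
[cite: Balaban1985Variational, Prop. 7 p.299 and Prop. 8 p.304] -/
theorem isMinOn_big_mem_small_of_existEv_T3 {L : ℕ} (hL : 1 < L) {B₃ a₁' O₁ a₅ a₁ : ℝ} (hB₃ : 0 < B₃) (hO₁ : 1 ≤ O₁)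
    (h1 : a₁ ≤ a₁') (h3 : a₁ ≤ a₅ / (O₁ * (L : ℝ) ^ 3 * B₃)) (n₀ : T3Family → ℕ)
    (H7 : ∀ (i : Idx L), n₀ i.1.1 ≤ i.1.2.1 → ∀ (ε₁ : ℝ), 0 < ε₁ → ε₁ ≤ a₁' → ∀ V : (famX L i).Bdry, (famX L i).Reg7 ε₁ V →
      ∀ U₀ : (famX L i).Cfg, (famX L i).InU ((L : ℝ) ^ 3 * B₃ * ε₁) U₀ → (famX L i).InB V U₀ →
        ∃ U : (famX L i).Cfg, (famX L i).OnMinimalOrbit (O₁ * (L : ℝ) ^ 3 * B₃ * ε₁) V U)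
    (H8 : ∀ (i : Idx L) (ε₀ ε₁ : ℝ), 0 < ε₁ → ∀ (V : (famX L i).Bdry) (U : (famX L i).Cfg),
      (famX L i).Reg7 ε₁ V → (famX L i).InU ε₀ U → (famX L i).InB V U → (famX L i).IsCritical V U → ε₀ ≤ a₅ → (famX L i).InU (B₃ * ε₁) U)
    (F : T3Family) (hF : F.L = L) {n K : ℕ} (hnK : n < K) (hn : n₀ F ≤ n) {ε₁ : ℝ} (hε₁ : 0 < ε₁) (hε₁a : ε₁ ≤ a₁)
    (V : GaugeField (F.P n) 0 (Matrix.specialUnitaryGroup (Fin 2) ℂ)) (hV : PlaqSmall ε₁ V)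
    (U₀ : GaugeField (F.P K) 0 (Matrix.specialUnitaryGroup (Fin 2) ℂ)) (hU₀ : RegPr F n K ((L : ℝ) ^ 3 * B₃ * ε₁) U₀)
    (hU₀B : U₀ ∈ fibre F ℰp n K hnK.le V) :
    ∃ U ∈ regFibrePr F n K hnK.le (B₃ * ε₁) V,
      IsMinOn (fun W : GaugeField (F.P K) 0 (Matrix.specialUnitaryGroup (Fin 2) ℂ) => wilsonAction4 W)
        (regFibrePr F n K hnK.le (O₁ * (L : ℝ) ^ 3 * B₃ * ε₁) V) U := by
  have hL1 : (1 : ℝ) ≤ L := by exact_mod_cast hL.le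
  have hK : 0 < O₁ * (L : ℝ) ^ 3 * B₃ := by positivity
  have hbig : 0 < O₁ * (L : ℝ) ^ 3 * B₃ * ε₁ := mul_pos hK hε₁
  -- Prop 8's window: `O₁L³B₃ε₁ ≤ a₅`
  have hε₀a₅ : O₁ * (L : ℝ) ^ 3 * B₃ * ε₁ ≤ a₅ := by
    have hKa : a₁ * (O₁ * (L : ℝ) ^ 3 * B₃) ≤ a₅ := (le_div_iff₀ hK).1 h3
    nlinarith [mul_le_mul_of_nonneg_left hε₁a hK.le]
  -- Prop 7 (ii) at the member (height `n ≥ n₀ F`): a global minimiser over the big fibre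
  obtain ⟨U, hU⟩ := H7 ⟨(F, n, K), hF, hnK⟩ hn ε₁ hε₁ (hε₁a.trans h1) V hV U₀ hU₀ hU₀B
  obtain ⟨hUmem, hUmin⟩ := (onMinimalOrbit_iff _ V U).mp hU
  -- it is critical in reading R2, so Prop 8 puts it in (8)(B₃ε₁)
  have hcrit : (famX L ⟨(F, n, K), hF, hnK⟩).IsCritical V U := ⟨_, hbig, hUmem, hUmin⟩
  have hIn : (famX L ⟨(F, n, K), hF, hnK⟩).InU (O₁ * (L : ℝ) ^ 3 * B₃ * ε₁) U := ((mem_regFibrePr_iff F).mp hUmem).2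
  have hB : (famX L ⟨(F, n, K), hF, hnK⟩).InB V U := hUmem.1.1
  have h8U : RegPr F n K (B₃ * ε₁) U := H8 ⟨(F, n, K), hF, hnK⟩ _ ε₁ hε₁ V U hV hIn hB hcrit hε₀a₅
  exact ⟨U, (mem_regFibrePr_iff F).mpr ⟨hB, h8U⟩, hUmin⟩

/-- **THE BACKGROUND SUPPLY OF SECT. A ABOVE THE THRESHOLD** (induction on `k = K − n`; `AttainmentOfExist.background_of_exist_T3` with the rider: the inductive step calls the
existence clause at height `n + 1 ≥ n₀(F)`, so the rider is carried unchanged — layer 2 is upward-closed in `n`). [cite: Balaban1985Variational, Sect. A (11)-(14) pp.279-280] -/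
theorem background_of_existEv_T3 {L : ℕ} (hL : 1 < L) {B₃ a₁' O₁ a₅ a₁ : ℝ} (hB₃ : 4 < B₃) (hO₁ : 1 ≤ O₁)
    (h1 : a₁ ≤ a₁') (h3 : a₁ ≤ a₅ / (O₁ * (L : ℝ) ^ 3 * B₃)) (n₀ : T3Family → ℕ)
    (H7 : ∀ (i : Idx L), n₀ i.1.1 ≤ i.1.2.1 → ∀ (ε₁ : ℝ), 0 < ε₁ → ε₁ ≤ a₁' → ∀ V : (famX L i).Bdry, (famX L i).Reg7 ε₁ V →
      ∀ U₀ : (famX L i).Cfg, (famX L i).InU ((L : ℝ) ^ 3 * B₃ * ε₁) U₀ → (famX L i).InB V U₀ →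
        ∃ U : (famX L i).Cfg, (famX L i).OnMinimalOrbit (O₁ * (L : ℝ) ^ 3 * B₃ * ε₁) V U)
    (H8 : ∀ (i : Idx L) (ε₀ ε₁ : ℝ), 0 < ε₁ → ∀ (V : (famX L i).Bdry) (U : (famX L i).Cfg),
      (famX L i).Reg7 ε₁ V → (famX L i).InU ε₀ U → (famX L i).InB V U → (famX L i).IsCritical V U → ε₀ ≤ a₅ → (famX L i).InU (B₃ * ε₁) U) :
    ∀ (k : ℕ) (F : T3Family), F.L = L → ∀ (n K : ℕ) (hnK : n < K), K - n = k + 1 → n₀ F ≤ n → ∀ ε₁ : ℝ, 0 < ε₁ → ε₁ ≤ a₁ →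
      ∀ V : GaugeField (F.P n) 0 (Matrix.specialUnitaryGroup (Fin 2) ℂ), PlaqSmall ε₁ V →
        ∃ U₀ : GaugeField (F.P K) 0 (Matrix.specialUnitaryGroup (Fin 2) ℂ),
          RegPr F n K ((L : ℝ) ^ 3 * B₃ * ε₁) U₀ ∧ U₀ ∈ fibre F ℰp n K hnK.le V := by
  have hB₃0 : 0 < B₃ := by linarith
  intro k
  induction k with
  | zero =>
    -- `k = 1`: «we take simply U₀ = V₀»
    intro F hF n K hnK hk _ ε₁ hε₁ _ V hV
    have hK : K = n + 1 := by omega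
    subst hK
    have hFL : ((F.L : ℕ) : ℝ) = (L : ℝ) := by rw [hF]
    obtain ⟨hreg, hfib⟩ := sat14_base F n hB₃ hε₁ hV
    rw [hFL] at hreg
    exact ⟨secTo F n (n + 1) (Nat.le_succ n) V, hreg, hfib⟩
  | succ k ih =>
    -- `k ↦ k + 1`: the (8)-member at height `n + 1 ≥ n₀ F` over `V₀ = secTo V`, lifted by (12)–(13)
    intro F hF n K hnK hk hn ε₁ hε₁ hε₁a V hV
    have hnK' : n + 1 < K := by omega
    have hn' : n₀ F ≤ n + 1 := hn.trans (Nat.le_succ n)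
    have hFL : ((F.L : ℕ) : ℝ) = (L : ℝ) := by rw [hF]
    have hV₀reg : PlaqSmall ε₁ (secTo F n (n + 1) (Nat.le_succ n) V) := plaqSmall_secTo F (Nat.le_succ n) hε₁ hV
    obtain ⟨U₁, hU₁, hU₁B⟩ := ih F hF (n + 1) K hnK' (by omega) hn' ε₁ hε₁ hε₁a _ hV₀reg
    obtain ⟨U', hU'mem, -⟩ :=
      isMinOn_big_mem_small_of_existEv_T3 hL hB₃0 hO₁ h1 h3 n₀ H7 H8 F hF hnK' hn' hε₁ hε₁a _ hV₀reg U₁ hU₁ hU₁B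
    have h13 := mem_regFibrePr_height_succ F hnK'.le (mul_pos hB₃0 hε₁).le hU'mem
    obtain ⟨hfib, hreg⟩ := (mem_regFibrePr_iff F).mp h13
    refine ⟨U', ?_, hfib⟩
    rw [← hFL, mul_assoc]
    exact hreg

/-- **ATTAINMENT OVER PRINT'S REGULAR FIBRE (6)(ε₀) ABOVE THE THRESHOLD, FROM PROP 7 (ii)-ev AND PROP 8 AT THE SAME `B₃ > 4`** (`AttainmentOfExist.minSixAttainedAt_of_exist_prop8`
with the rider): `∃ â₀ â₁ > 0` such that for every member `F` of block size `L`, heights `n₀(F) ≤ n < K`, `0 < ε₁ ≤ â₁`, `B₃ε₁ ≤ ε₀ ≤ â₀` and every (7)-datum `V`, the Wilson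
action attains its infimum over `regFibrePr F n K _ ε₀ V` (= the text of `T3ExistSplit.MinSixAttainedAt L â₀ â₁ B₃` with the one antecedent `n₀ F ≤ n` inserted).
[cite: Balaban1985Variational, Prop. 7 p.299 and Prop. 8 p.304] -/
theorem minSixAttainedEv_of_existEv_prop8 {L : ℕ} (hL : 1 < L) {B₃ : ℝ} (hB₃ : 4 < B₃) (n₀ : T3Family → ℕ)
    (H7 : ∃ a₁' O₁ : ℝ, 0 < a₁' ∧ 1 ≤ O₁ ∧ ∀ (i : Idx L), n₀ i.1.1 ≤ i.1.2.1 → ∀ (ε₁ : ℝ), 0 < ε₁ → ε₁ ≤ a₁' →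
      ∀ V : (famX L i).Bdry, (famX L i).Reg7 ε₁ V → ∀ U₀ : (famX L i).Cfg, (famX L i).InU ((L : ℝ) ^ 3 * B₃ * ε₁) U₀ → (famX L i).InB V U₀ →
        ∃ U : (famX L i).Cfg, (famX L i).OnMinimalOrbit (O₁ * (L : ℝ) ^ 3 * B₃ * ε₁) V U)
    (H8 : Prop8Printed B₃ (famX L)) :
    ∃ â₀ â₁ : ℝ, 0 < â₀ ∧ 0 < â₁ ∧
      ∀ F : T3Family, F.L = L → ∀ (n K : ℕ) (hnK : n < K), n₀ F ≤ n → ∀ (ε₁ ε₀ : ℝ), 0 < ε₁ → ε₁ ≤ â₁ → B₃ * ε₁ ≤ ε₀ → ε₀ ≤ â₀ →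
        ∀ V : GaugeField (F.P n) 0 (Matrix.specialUnitaryGroup (Fin 2) ℂ), PlaqSmall ε₁ V →
          ∃ U ∈ regFibrePr F n K hnK.le ε₀ V,
            IsMinOn (fun W : GaugeField (F.P K) 0 (Matrix.specialUnitaryGroup (Fin 2) ℂ) => wilsonAction4 W) (regFibrePr F n K hnK.le ε₀ V) U := by
  obtain ⟨a₁', O₁, ha₁', hO₁, H7⟩ := H7
  obtain ⟨a₅, ha₅, H8⟩ := H8
  have hB₃0 : 0 < B₃ := by linarith
  have hL1 : (1 : ℝ) ≤ L := by exact_mod_cast hL.le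
  have hK : 0 < O₁ * (L : ℝ) ^ 3 * B₃ := by positivity
  set a₁ : ℝ := min a₁' (a₅ / (O₁ * (L : ℝ) ^ 3 * B₃)) with ha₁_def
  have ha₁ : 0 < a₁ := lt_min ha₁' (div_pos ha₅ hK)
  have h1 : a₁ ≤ a₁' := min_le_left _ _
  have h3 : a₁ ≤ a₅ / (O₁ * (L : ℝ) ^ 3 * B₃) := min_le_right _ _
  have hbg := background_of_existEv_T3 hL hB₃ hO₁ h1 h3 n₀ H7 H8
  refine ⟨O₁ * (L : ℝ) ^ 3 * B₃ * a₁, a₁, mul_pos hK ha₁, ha₁, ?_⟩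
  intro F hF n K hnK hn ε₁ ε₀ hε₁ hε₁a hlo hhi V hV
  by_cases hcase : ε₀ ≤ O₁ * (L : ℝ) ^ 3 * B₃ * ε₁
  · -- LOW window
    obtain ⟨U₀, hU₀, hU₀B⟩ := hbg (K - n - 1) F hF n K hnK (by omega) hn ε₁ hε₁ hε₁a V hV
    obtain ⟨U, hU8, hUmin⟩ :=
      isMinOn_big_mem_small_of_existEv_T3 hL hB₃0 hO₁ h1 h3 n₀ H7 H8 F hF hnK hn hε₁ hε₁a V hV U₀ hU₀ hU₀B
    exact ⟨U, regFibrePr_mono F hlo V hU8, hUmin.on_subset (regFibrePr_mono F hcase V)⟩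
  · -- HIGH window: the datum is (7)-small at `ε₁′ := ε₀∕(O₁L³B₃) ∈ (ε₁, a₁]`
    rw [not_le] at hcase
    have hε₀ : 0 < ε₀ := (mul_pos hK hε₁).trans hcase
    set ε₁' : ℝ := ε₀ / (O₁ * (L : ℝ) ^ 3 * B₃) with hε₁'_def
    have hε₁' : 0 < ε₁' := div_pos hε₀ hK
    have hε₁le : ε₁ ≤ ε₁' := by
      rw [hε₁'_def, le_div_iff₀ hK]
      nlinarith
    have hε₁'a : ε₁' ≤ a₁ := by
      rw [hε₁'_def, div_le_iff₀ hK]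
      nlinarith
    have heq : O₁ * (L : ℝ) ^ 3 * B₃ * ε₁' = ε₀ := by
      rw [hε₁'_def]
      field_simp
    have hV' : PlaqSmall ε₁' V := plaqSmall_of_le hε₁le hV
    obtain ⟨U₀, hU₀, hU₀B⟩ := hbg (K - n - 1) F hF n K hnK (by omega) hn ε₁' hε₁' hε₁'a V hV'
    obtain ⟨U, hU⟩ := H7 ⟨(F, n, K), hF, hnK⟩ hn ε₁' hε₁' (hε₁'a.trans h1) V hV' U₀ hU₀ hU₀B
    obtain ⟨hUmem, hUmin⟩ := (onMinimalOrbit_iff _ V U).mp hU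
    rw [heq] at hUmem hUmin
    exact ⟨U, hUmem, hUmin⟩

/-! ## §2 EXIST above the threshold: `HasRegMinimisersPrAt` with `K₀ := m·n₀(F) + 1` -/

/-- **THE EXIST SCHEMA FROM ATTAINMENT ABOVE A PER-FAMILY HEIGHT THRESHOLD** (`T3ExistSplit.hasRegMinimisersPrAt_of_attained` with the rider): layer 3 reads only the members
`(F, ⌊K∕m⌋, K)`, `(F, ⌊K∕m⌋, K+1)`, and `HasRegMinimisersPrAt` allows a threshold `K₀` per family — take `K₀ := m·n₀(F) + 1`, so that `⌊K∕m⌋ ≥ n₀(F)` for `K ≥ K₀`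
(`Nat.le_div_iff_mul_le`). [cite: Balaban1985Variational, Thm 1 p.279 and Prop 7 p.299] -/
theorem hasRegMinimisersPrAt_of_attainedEv {L : ℕ} {a₀ a₁ B₃ : ℝ} (ha₀ : 0 < a₀) (ha₁ : 0 < a₁) (hB₃ : 0 < B₃) (n₀ : T3Family → ℕ)
    (hatt : ∀ F : T3Family, F.L = L → ∀ (n K : ℕ) (hnK : n < K), n₀ F ≤ n → ∀ (ε₁ ε₀ : ℝ), 0 < ε₁ → ε₁ ≤ a₁ → B₃ * ε₁ ≤ ε₀ → ε₀ ≤ a₀ →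
      ∀ V : GaugeField (F.P n) 0 (Matrix.specialUnitaryGroup (Fin 2) ℂ), PlaqSmall ε₁ V →
        ∃ U ∈ regFibrePr F n K hnK.le ε₀ V,
          IsMinOn (fun W : GaugeField (F.P K) 0 (Matrix.specialUnitaryGroup (Fin 2) ℂ) => wilsonAction4 W) (regFibrePr F n K hnK.le ε₀ V) U) :
    ∃ ε₁' : ℝ, 0 < ε₁' ∧ ∀ ε₀ : ℝ, 0 < ε₀ → ε₀ ≤ ε₁' → ∀ m : ℕ, 2 ≤ m → ∀ b₀ p₀ : ℝ, 0 < b₀ →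
      ∃ γ₁ : ℝ, 0 < γ₁ ∧ ∀ (F : T3Family) (γ : ℝ), F.L = L → 0 < γ → γ ≤ γ₁ → HasRegMinimisersPrAt F γ b₀ p₀ m ε₀ := by
  refine ⟨a₀, ha₀, fun ε₀ hε₀ hε₀a m hm b₀ p₀ hb => ?_⟩
  by_cases hL : 1 ≤ L
  · have hσ : 0 < min a₁ (ε₀ / B₃) := lt_min ha₁ (div_pos hε₀ hB₃)
    obtain ⟨γ₁, hγ₁, hθ⟩ := exists_forall_θBal_le hL b₀ p₀ hσ
    refine ⟨min γ₁ 1, lt_min hγ₁ one_pos, fun F γ hF hγ hγle => ?_⟩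
    have hγ₁' : γ ≤ γ₁ := hγle.trans (min_le_left _ _)
    have hγ1 : γ ≤ 1 := hγle.trans (min_le_right _ _)
    refine ⟨m * n₀ F + 1, fun K hK V hV => ?_⟩
    have hm0 : 0 < m := by omega
    have hnK : K / m < K := Nat.div_lt_self (by omega) (by omega)
    have hnK' : K / m < K + 1 := hnK.trans (Nat.lt_succ_self K)
    have hn : n₀ F ≤ K / m := (Nat.le_div_iff_mul_le hm0).mpr (by rw [Nat.mul_comm]; omega)
    have hFL : 1 ≤ F.L := F.hL.2.le
    have hε₁ : 0 < θBal F.L γ b₀ p₀ (K / m) := θBal_pos hFL hγ hγ1 hb p₀ (K / m)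
    have hθle : θBal F.L γ b₀ p₀ (K / m) ≤ min a₁ (ε₀ / B₃) := by rw [hF]; exact hθ γ hγ hγ₁' (K / m)
    have hε₁a : θBal F.L γ b₀ p₀ (K / m) ≤ a₁ := hθle.trans (min_le_left _ _)
    have hlo : B₃ * θBal F.L γ b₀ p₀ (K / m) ≤ ε₀ := by
      have h := mul_le_mul_of_nonneg_left (hθle.trans (min_le_right _ _)) hB₃.le
      rwa [mul_div_cancel₀ _ hB₃.ne'] at h
    obtain ⟨U, hU, hmin⟩ := hatt F hF (K / m) K hnK hn _ ε₀ hε₁ hε₁a hlo hε₀a V hV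
    obtain ⟨U', hU', hmin'⟩ := hatt F hF (K / m) (K + 1) hnK' hn _ ε₀ hε₁ hε₁a hlo hε₀a V hV
    exact ⟨⟨U, hU, minActionRegPr_eq_of_isMinOn F hU hmin⟩, ⟨U', hU', minActionRegPr_eq_of_isMinOn F hU' hmin'⟩⟩
  · refine ⟨1, one_pos, fun F γ hF _ _ => ?_⟩
    exact absurd (hF ▸ F.hL.2.le) hL

/-! ## §3 The door: `MinimiserStabilityRegPr` from the halving text and EX-ev -/

/-- The registered existence text (all members) implies EX-ev (rider `n₀ := 0`); with the door below this recovers the landed all-member composition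
✓`AttainmentOfExistence.MinimiserStabilityRegPr_of_halvingStep_of_existence` (cited, not restated). [cite: Balaban1985Variational, Prop. 7 p.299] -/
theorem existEv_of_exist
    (hEX : ∀ (L : ℕ), 1 < L → ∀ (B₃ : ℝ), 4 < B₃ → ∃ a₁' O₁ : ℝ, 0 < a₁' ∧ 1 ≤ O₁ ∧
      ∀ (F : T3Family), F.L = L → ∀ (n K : ℕ) (hnK : n < K) (ε₁ : ℝ), 0 < ε₁ →
        ∀ V : GaugeField (F.P n) 0 (Matrix.specialUnitaryGroup (Fin 2) ℂ), PlaqSmall ε₁ V →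
          ∀ U₀ : GaugeField (F.P K) 0 (Matrix.specialUnitaryGroup (Fin 2) ℂ), RegPr F n K ((L : ℝ) ^ 3 * B₃ * ε₁) U₀ → U₀ ∈ fibre F ℰp n K hnK.le V →
            ε₁ ≤ a₁' → ∃ U ∈ regFibrePr F n K hnK.le (O₁ * (L : ℝ) ^ 3 * B₃ * ε₁) V,
              IsMinOn (fun W : GaugeField (F.P K) 0 (Matrix.specialUnitaryGroup (Fin 2) ℂ) => wilsonAction4 W)
                (regFibrePr F n K hnK.le (O₁ * (L : ℝ) ^ 3 * B₃ * ε₁) V) U) :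
    ∀ (L : ℕ), 1 < L → ∀ (B₃ : ℝ), 4 < B₃ → ∃ a₁' O₁ : ℝ, 0 < a₁' ∧ 1 ≤ O₁ ∧
      ∀ (F : T3Family), F.L = L → ∃ n₀ : ℕ, ∀ (n K : ℕ) (hnK : n < K), n₀ ≤ n → ∀ (ε₁ : ℝ), 0 < ε₁ →
        ∀ V : GaugeField (F.P n) 0 (Matrix.specialUnitaryGroup (Fin 2) ℂ), PlaqSmall ε₁ V →
          ∀ U₀ : GaugeField (F.P K) 0 (Matrix.specialUnitaryGroup (Fin 2) ℂ), RegPr F n K ((L : ℝ) ^ 3 * B₃ * ε₁) U₀ → U₀ ∈ fibre F ℰp n K hnK.le V →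
            ε₁ ≤ a₁' → ∃ U ∈ regFibrePr F n K hnK.le (O₁ * (L : ℝ) ^ 3 * B₃ * ε₁) V,
              IsMinOn (fun W : GaugeField (F.P K) 0 (Matrix.specialUnitaryGroup (Fin 2) ℂ) => wilsonAction4 W)
                (regFibrePr F n K hnK.le (O₁ * (L : ℝ) ^ 3 * B₃ * ε₁) V) U := by
  intro L hL B₃ hB₃
  obtain ⟨a₁', O₁, ha₁', hO₁, h⟩ := hEX L hL B₃ hB₃
  exact ⟨a₁', O₁, ha₁', hO₁, fun F hF => ⟨0, fun n K hnK _ ε₁ hε₁ V hV U₀ hU₀ hU₀B hε₁a => h F hF n K hnK ε₁ hε₁ V hV U₀ hU₀ hU₀B hε₁a⟩⟩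

/-- **THE «EVENTUALLY-IN-HEIGHT» DOOR — `MinimiserStabilityRegPr ⇐ HALVING ∧ EX-ev`.**  Hypotheses: `hH` = the text of `BirthV10.stub_halvingStep` VERBATIM ([Balaban1985Variational] Sect. F
one-step halving); `hEX` = the text of `BirthV10.stub_existenceMinimalOrbit` with ONE inserted antecedent per family, «`∃ n₀, ∀ n K (hnK : n < K), n₀ ≤ n → …`» (Prop. 7 (ii) from a
(14)-background, for the members whose coarse height `n` is above a per-family threshold — e.g. the volume rider `a′(L) + 3 ≤ F.m + n` of a [Balaban1985BackgroundPropagators]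
Thm 3.1-shaped supplier, `n₀(F) := a′(L) + 3 − F.m`).  Proof = `birth_v10` §2–§3 over the landed leaves with §1–§2 in place of `minSixAttainedAt_of_exist_prop8` ∕
`hasRegMinimisersPrAt_of_attained`: Prop 8 by `Prop8Iter.prop8_of_halvingLiteral`, V4′ `CritCurvGradLog.stub_critCurvGradLog`, `SmoothLift`, `AvgCurvGrad`, `AvgActionDefect`, UPPER by
`upperAlongRegPrMinimisersAt_of_splitLog'`, LOWER by `lowerAlongRegPrMinimisersAt_of_splitLog'''`, then `minimiserStabilityRegPrAt_of_alongRegPrMinimisers`; `ε₁ := min`, `m₀ := 10`, `γ₁ := min`.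
[cite: Balaban1985Variational, Thm 1 (8) p.279, Prop. 7 p.299, Prop. 8 p.304; Balaban1985UV3, (41) p.266] -/
theorem minimiserStabilityRegPr_of_halving_existEv
    (hH : ∀ (L : ℕ), 1 < L → ∃ B₃ : ℝ, 4 < B₃ ∧ ∃ a₅ : ℝ, 0 < a₅ ∧
      ∀ (i : Idx L) (ε₀ ε₁ : ℝ), 0 < ε₁ → ∀ (V : (famX L i).Bdry) (U : (famX L i).Cfg), (famX L i).Reg7 ε₁ V → (famX L i).InU ε₀ U →
        (famX L i).InB V U → (famX L i).IsCritical V U → ε₀ ≤ a₅ → (famX L i).InU (max (B₃ * ε₁) (ε₀ / 2)) U)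
    (hEX : ∀ (L : ℕ), 1 < L → ∀ (B₃ : ℝ), 4 < B₃ → ∃ a₁' O₁ : ℝ, 0 < a₁' ∧ 1 ≤ O₁ ∧
      ∀ (F : T3Family), F.L = L → ∃ n₀ : ℕ, ∀ (n K : ℕ) (hnK : n < K), n₀ ≤ n → ∀ (ε₁ : ℝ), 0 < ε₁ →
        ∀ V : GaugeField (F.P n) 0 (Matrix.specialUnitaryGroup (Fin 2) ℂ), PlaqSmall ε₁ V →
          ∀ U₀ : GaugeField (F.P K) 0 (Matrix.specialUnitaryGroup (Fin 2) ℂ), RegPr F n K ((L : ℝ) ^ 3 * B₃ * ε₁) U₀ → U₀ ∈ fibre F ℰp n K hnK.le V →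
            ε₁ ≤ a₁' → ∃ U ∈ regFibrePr F n K hnK.le (O₁ * (L : ℝ) ^ 3 * B₃ * ε₁) V,
              IsMinOn (fun W : GaugeField (F.P K) 0 (Matrix.specialUnitaryGroup (Fin 2) ℂ) => wilsonAction4 W)
                (regFibrePr F n K hnK.le (O₁ * (L : ℝ) ^ 3 * B₃ * ε₁) V) U) :
    Summit.QuantumFields.YangMills.Theses.UnitScaleTilt.MinimiserStabilityRegPr := by
  intro L
  by_cases hL : 1 < L
  · -- Prop 8 from the halving text, at some `B₃ > 4`
    obtain ⟨B₃, hB₃, h8⟩ := Summit.QuantumFields.YangMills.Theorems.Prop8Iter.prop8_of_halvingLiteral hH L hL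
    have hB₃0 : 0 < B₃ := by linarith
    -- EX-ev at this `B₃`, per-family thresholds chosen
    obtain ⟨a₁', O₁, ha₁', hO₁, hE⟩ := hEX L hL B₃ hB₃
    have hE' : ∀ F : T3Family, ∃ n₀ : ℕ, F.L = L → ∀ (n K : ℕ) (hnK : n < K), n₀ ≤ n → ∀ (ε₁ : ℝ), 0 < ε₁ →
        ∀ V : GaugeField (F.P n) 0 (Matrix.specialUnitaryGroup (Fin 2) ℂ), PlaqSmall ε₁ V →
          ∀ U₀ : GaugeField (F.P K) 0 (Matrix.specialUnitaryGroup (Fin 2) ℂ), RegPr F n K ((L : ℝ) ^ 3 * B₃ * ε₁) U₀ → U₀ ∈ fibre F ℰp n K hnK.le V →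
            ε₁ ≤ a₁' → ∃ U ∈ regFibrePr F n K hnK.le (O₁ * (L : ℝ) ^ 3 * B₃ * ε₁) V,
              IsMinOn (fun W : GaugeField (F.P K) 0 (Matrix.specialUnitaryGroup (Fin 2) ℂ) => wilsonAction4 W)
                (regFibrePr F n K hnK.le (O₁ * (L : ℝ) ^ 3 * B₃ * ε₁) V) U := by
      intro F
      by_cases hF : F.L = L
      · obtain ⟨n₀, h⟩ := hE F hF
        exact ⟨n₀, fun _ => h⟩
      · exact ⟨0, fun h => absurd h hF⟩
    choose n₀ hn₀ using hE'
    -- EX-ev in the carrier form `famX`∕`OnMinimalOrbit` (anonymous-constructor defeq)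
    have h7 : ∃ a₁' O₁ : ℝ, 0 < a₁' ∧ 1 ≤ O₁ ∧ ∀ (i : Idx L), n₀ i.1.1 ≤ i.1.2.1 → ∀ (ε₁ : ℝ), 0 < ε₁ → ε₁ ≤ a₁' →
        ∀ V : (famX L i).Bdry, (famX L i).Reg7 ε₁ V → ∀ U₀ : (famX L i).Cfg, (famX L i).InU ((L : ℝ) ^ 3 * B₃ * ε₁) U₀ → (famX L i).InB V U₀ →
          ∃ U : (famX L i).Cfg, (famX L i).OnMinimalOrbit (O₁ * (L : ℝ) ^ 3 * B₃ * ε₁) V U := by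
      refine ⟨a₁', O₁, ha₁', hO₁, ?_⟩
      intro i hi ε₁ hε₁ hε₁a V hV U₀ hU₀ hB
      obtain ⟨⟨F, n, K⟩, hF, hnK⟩ := i
      obtain ⟨U, hU, hmin⟩ := hn₀ F hF n K hnK hi ε₁ hε₁ V hV U₀ hU₀ hB hε₁a
      exact ⟨U, hU, hmin⟩
    -- attainment above the thresholds; (8)-membership and the log-Lipschitz schema for all members (Prop 8, V4′)
    obtain ⟨â₀, â₁, hâ₀, hâ₁, hatt⟩ := minSixAttainedEv_of_existEv_prop8 hL hB₃ n₀ h7 h8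
    obtain ⟨a₁, B₄, ha₁, hB₄, hc⟩ := Summit.QuantumFields.YangMills.Theorems.CritCurvGradLog.stub_critCurvGradLog L hL B₃ hB₃
    obtain ⟨a₀, ha₀, hIn8'⟩ := minimisersIn8At_of_prop8 hB₃0 h8
    have hIn8 : MinimisersIn8At L a₀ a₁ B₃ := hIn8' a₁
    have hgrad : MinimiserCurvGradLogAt L a₀ a₁ B₃ B₄ := minimiserCurvGradLogAt_of_crit hB₃0 hc hIn8
    -- EXIST
    obtain ⟨e₁, he₁, hEx⟩ := hasRegMinimisersPrAt_of_attainedEv hâ₀ hâ₁ hB₃0 n₀ hatt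
    -- UPPER
    obtain ⟨C₁, C₂, c, hC₁, hC₂, hcc, hlift⟩ := Summit.QuantumFields.YangMills.Theorems.SmoothLift.stub_smoothLift L
    obtain ⟨e₂, he₂, hU⟩ := upperAlongRegPrMinimisersAt_of_splitLog' ha₀ ha₁ hB₃0 hB₄ hC₁ hC₂ hcc hIn8 hgrad hlift
    -- LOWER
    obtain ⟨D₁, D₂, d, hD₁, hD₂, hd, havg⟩ := Summit.QuantumFields.YangMills.Theorems.AvgCurvGrad.stub_avgCurvGrad L
    obtain ⟨E₂, e, hE₂, he, hdef⟩ := Summit.QuantumFields.YangMills.Theorems.AvgActionDefect.stub_avgActionDefect L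
    obtain ⟨e₃, he₃, hLo⟩ := lowerAlongRegPrMinimisersAt_of_splitLog''' hL.le ha₀ ha₁ hB₃0 hB₄ hD₂ hd hE₂ he hIn8 hgrad havg hdef
    -- the common `ε₁`, `m₀ = 10`, `γ₁`
    refine ⟨min e₁ (min e₂ e₃), lt_min he₁ (lt_min he₂ he₃), fun ε₀ hε hεle => ⟨10, fun m hm b₀ p₀ hb hp => ?_⟩⟩
    have hε₁ : ε₀ ≤ e₁ := hεle.trans (min_le_left _ _)
    have hε₂ : ε₀ ≤ e₂ := hεle.trans ((min_le_right _ _).trans (min_le_left _ _))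
    have hε₃ : ε₀ ≤ e₃ := hεle.trans ((min_le_right _ _).trans (min_le_right _ _))
    have hm2 : 2 ≤ m := le_trans (by norm_num) hm
    have hp0 : 0 < p₀ := lt_trans two_pos hp
    obtain ⟨γa, hγa, hA⟩ := hEx ε₀ hε hε₁ m hm2 b₀ p₀ hb
    obtain ⟨γb, hγb, hB⟩ := hU ε₀ hε hε₂ m hm b₀ p₀ hb hp0
    obtain ⟨γc, hγc, hC⟩ := hLo ε₀ hε hε₃ m hm b₀ p₀ hb hp0
    refine ⟨min γa (min γb γc), lt_min hγa (lt_min hγb hγc), fun F γ hFL hγ hγle => ?_⟩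
    have hγa' : γ ≤ γa := hγle.trans (min_le_left _ _)
    have hγb' : γ ≤ γb := hγle.trans ((min_le_right _ _).trans (min_le_left _ _))
    have hγc' : γ ≤ γc := hγle.trans ((min_le_right _ _).trans (min_le_right _ _))
    exact minimiserStabilityRegPrAt_of_alongRegPrMinimisers hγ.le (hA F γ hFL hγ hγa') (hB F γ hFL hγ hγb') (hC F γ hFL hγ hγc')
  · -- no member of the family has block size `L ≤ 1`
    exact ⟨1, one_pos, fun ε₀ _ _ => ⟨0, fun m _ b₀ p₀ _ _ => ⟨1, one_pos, fun F γ hFL _ _ => absurd (hFL ▸ F.hL.2) hL⟩⟩⟩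

end Summit.QuantumFields.YangMills.Theorems.MinimiserStabilityRegPrOfExistEv

end
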